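import Literature.AnabelianGeometry.EtaleTheta.Discharge.Sec2TemperedCoverDataModel
import Literature.AnabelianGeometry.EtaleTheta.ThetaCoversTempered
import Literature.AnabelianGeometry.EtaleTheta.Discharge.Sec2ProfiniteCompletion
import Mathlib.GroupTheory.Commutator.Basic
import HarnessLib

/-!
# [EtTh] §2: the binder `hΘ` («`Δ̄_Θ` is the image of `[Δ_X, Δ_X]`») is NOT derivable from the typed cover interface —
# a kernel certificate at the model «Heisenberg ⋊ D_l × Tate ℤ ⊆ Ẑ» (proof-only; GAP-LEDGER G-L2d3-1, v-next item S2-3)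

S. Mochizuki, *The étale theta function …*, Publ. RIMS **45** (2009) [MochizukiEtTh2009], §1 p.238 (PDF p.12) «`Δ_Θ :=
Im(∧² Δ^ab_X)`», §2 p.261 (PDF p.35) «`1 → Δ̄_Θ → Δ̄_X → Δ̄^ell_X → 1`», Rmk. 2.6.1 p.266, Cor. 2.9 p.269.  abc-iut cell, layer L2,
seat abc-iut-w5-d118 (companion of the model `ThetaCoversTemperedModelDefs.lean` p430754 / `Sec2TemperedCoverDataModel*.lean`
p430914/p431045).  PROOF-ONLY (0 definitions).

The discharges of [EtTh] Rmk. 2.6.1 / Cor. 2.9 by abc-iut-L2-d3 (`rmk261_of (hΘ)`, `cor29_card_of (… hΘ …)`) carry the binder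
  `hΘ : ⁅X.DeltaX, X.DeltaX⁆ ⊔ X.barKer = X.barTheta`   (GAP-LEDGER G-L2d3-1: "MISSING INTERFACE FIELD — `CoverData` admits models
with `Δ̄_X` abelian"; proposed v-next field `commutator_sup_barKer`, census item S2-3).  Here that remark becomes a KERNEL certificate:
at the model of `CoverDataAx` / `TemperedCoverData` of `ThetaCoversTemperedModelDefs.lean` (`Δ̄_Θ :=` the Tate direction `Ẑ/lẐ`),
every commutator of `Δ_X` already lies in `Ker(Δ_X ↠ Δ̄_X)` (`Φ`-part: the Heisenberg commutator lands in `heisTheta`; `Ψ`-part: `Ẑ`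
is abelian), so `Δ̄_X ≅ (ℤ/l)³` is ABELIAN and `⁅Δ_X, Δ_X⁆ · Ker = Ker ≠ Δ̄_Θ-preimage` (index `l ≠ 1`):

* `commutator_le_barKerM` — `⁅Δ_X, Δ_X⁆ ⊆ Ker` at the model;
* `not_hTheta_model` — `hΘ` FAILS for `TemperedModel.coverDataAx l hl` (`l ≠ 1`);
* `not_forall_hTheta_coverDataAx` / `not_forall_hTheta_temperedCoverData` — `hΘ` is not a consequence of `CoverDataAx` nor of
  `TemperedCoverData` as typed (the latter via the `TemperedCoverData` literal of `Sec2TemperedCoverDataModel.lean`).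

HONEST FRAMING: a statement about OUR interface (which printed property it fails to record), complementary to abc-iut-L2-t11's
positive discharge of `hΘ` at the GENUINE §1 setting; nothing printed is refuted; no side taken on [IUTchIII] Cor. 3.12; typed ≠ proved.
-/

noncomputable section

namespace Literature.AnabelianGeometry.EtaleTheta

namespace ThetaCovers

namespace TemperedModel

open Multiplicative HeisenbergWitness Literature.AnabelianGeometry.SemiGraphs
  Literature.AnabelianGeometry.EtaleTheta.SettingModel
open scoped commutatorElement

variable (l : ℕ) [NeZero l]

/-- **`⁅Δ_X, Δ_X⁆ ⊆ Ker(Δ_X ↠ Δ̄_X)` at the model**: the `Φ`-component of a commutator of `Π_X = Φ⁻¹(heisPiX)` is a commutator of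
the mod-`l` Heisenberg group, hence in its centre `heisTheta` (the toy's `commutator_sup_barKer`), and its `Ψ`-component dies in the
abelian `ℤ/l`. [cite: MochizukiEtTh2009, Def 2.1 p.36] -/
theorem commutator_le_barKerM (hl : Odd l) :
    ⁅(coverDataAx l hl).toCoverData.DeltaX, (coverDataAx l hl).toCoverData.DeltaX⁆ ≤ barKerM l := by
  change ⁅PiXM l ⊓ (1 : PiCM l →* PUnit.{1}).ker, PiXM l ⊓ (1 : PiCM l →* PUnit.{1}).ker⁆ ≤ barKerM l
  rw [MonoidHom.ker_one, inf_top_eq, Subgroup.commutator_le]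
  intro x hx y hy
  have htoy : ⁅heisPiX l ⊓ (1 : heisPiC l →* PUnit.{1}).ker, heisPiX l ⊓ (1 : heisPiC l →* PUnit.{1}).ker⁆ ≤ heisTheta l := by
    have h := commutator_sup_barKer l hl
    exact le_sup_left.trans h.le
  refine ⟨?_, ?_⟩
  · change Phi l ⁅x, y⁆ ∈ heisTheta l
    rw [commutatorElement_def, map_mul, map_mul, map_mul, map_inv, map_inv, ← commutatorElement_def]
    exact htoy (Subgroup.commutator_mem_commutator ⟨hx, mem_ker_one l _⟩ ⟨hy, mem_ker_one l _⟩)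
  · show ⁅x, y⁆ ∈ (Psi l).ker
    rw [commutatorElement_def]
    exact Psi_comm_mem_ker l x y

/-- `Ker ≠ Δ̄_Θ-preimage` at the model when `l ≠ 1` (`[Δ̄_Θ-preimage : Ker] = l`). [cite: MochizukiEtTh2009, Def 2.1 p.36] -/
theorem barKerM_ne_barThetaM (hl1 : l ≠ 1) : barKerM l ≠ barThetaM l := by
  intro h
  have hidx := relIndex_barKerM l
  rw [h, Subgroup.relIndex_self] at hidx
  exact hl1 hidx.symm

/-- **`hΘ` FAILS at the model** (`l ≠ 1`): `⁅Δ_X, Δ_X⁆ · Ker = Ker ≠ Δ̄_Θ-preimage` — the model's `Δ̄_X ≅ (ℤ/l)³` is abelian.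
[cite: MochizukiEtTh2009, Rmk 2.6.1 p.40] -/
theorem not_hTheta_model (hl : Odd l) (hl1 : l ≠ 1) :
    ¬ (⁅(coverDataAx l hl).toCoverData.DeltaX, (coverDataAx l hl).toCoverData.DeltaX⁆ ⊔ (coverDataAx l hl).barKer =
        (coverDataAx l hl).barTheta) := by
  intro h
  have hsup : ⁅(coverDataAx l hl).toCoverData.DeltaX, (coverDataAx l hl).toCoverData.DeltaX⁆ ⊔ (coverDataAx l hl).barKer =
      barKerM l := sup_eq_right.mpr (commutator_le_barKerM l hl)
  exact barKerM_ne_barThetaM l hl1 (hsup.symm.trans h)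

/-- **INDEPENDENCE CERTIFICATE (GAP-LEDGER G-L2d3-1), profinite interface**: the binder `hΘ` of abc-iut-L2-d3's Rmk. 2.6.1 /
Cor. 2.9 discharges is NOT a consequence of `ThetaCovers.CoverDataAx` as typed. [cite: MochizukiEtTh2009, Rmk 2.6.1 p.40] -/
theorem not_forall_hTheta_coverDataAx (hl : Odd l) (hl1 : l ≠ 1) :
    ¬ ∀ X : CoverDataAx.{0} l, ⁅X.toCoverData.DeltaX, X.toCoverData.DeltaX⁆ ⊔ X.barKer = X.barTheta :=
  fun h => not_hTheta_model l hl hl1 (h (coverDataAx l hl))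

/-- **INDEPENDENCE CERTIFICATE (GAP-LEDGER G-L2d3-1), tempered interface**: `hΘ` is NOT a consequence of
`ThetaCovers.TemperedCoverData` either — the tempered model of `Sec2TemperedCoverDataModel.lean` extends the same profinite data.
[cite: MochizukiEtTh2009, Rmk 2.6.1 p.40] -/
theorem not_forall_hTheta_temperedCoverData (hl : Odd l) (hl1 : l ≠ 1) :
    ¬ ∀ T : TemperedCoverData.{0} l, ⁅T.toCoverData.DeltaX, T.toCoverData.DeltaX⁆ ⊔ T.barKer = T.barTheta := by
  haveI := TAX_normal l
  haveI : ((TAX l).prod (⊥ : Subgroup (Multiplicative ℤ))).Normal := Subgroup.prod_normal _ _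
  intro h
  let T : TemperedCoverData.{0} l :=
    { toCoverDataAx := coverDataAx l hl
      PiCuu := PiCuuM l
      isTypeLTorsThetaPm := isTypeLTorsThetaPm_PiCuuM l hl
      isOpen_PiCuu' := isOpen_PiCuuM l
      Gtp := GtpM l
      toHat := (toHatM l).toMonoidHom
      continuous_toHat := (toHatM l).continuous
      injective_toHat := toHatM_injective l
      isProfiniteCompletion_toHat := isProfiniteCompletion_prodMap_etaCont (TA l) (Multiplicative ℤ)
      PiYtp := (TAX l).prod ⊥
      PiYtp_le := by
        change (TAX l).prod ⊥ ≤ (PiXM l).comap (toHatM l).toMonoidHom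
        rw [comap_toHatM_PiXM]
        exact Subgroup.prod_mono le_rfl bot_le
      PiYtp_normal := inferInstance
      isOpen_PiYtp := isOpen_discrete _
      quotZ := nonempty_quotZ l
      PiYddtp := ((TAX l ⊓ (TA.two l).ker)).prod ⊥
      PiYddtp_le := Subgroup.prod_mono inf_le_left le_rfl
      isOpen_PiYddtp := isOpen_discrete _
      relIndex_PiYddtp := relIndex_PiYddtp l
      PiCdot := ((TA.two l).ker).prod ⊤
      index_PiCdot := index_PiCdot l
      isOpen_PiCdot := isOpen_discrete _
      PiCdot_ne := PiCdot_ne l }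
  exact not_hTheta_model l hl hl1 (h T)

end TemperedModel

end ThetaCovers

end Literature.AnabelianGeometry.EtaleTheta
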